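import Summits.AtomisticToContinuum.HydrodynamicLimit.Theorems.InformationPercolationEngineChaosClosesEulerDissipationRigidityC
import Summits.AtomisticToContinuum.HydrodynamicLimit.Theorems.InformationPercolationEngineChaosClosesEulerDissipationRigidityE
import Summits.AtomisticToContinuum.HydrodynamicLimit.Theorems.InformationPercolationEngineChaosClosesEulerDissipationRigidityF
import Summits.AtomisticToContinuum.HydrodynamicLimit.Theorems.InformationPercolationEngineChaosClosesEulerWeakLimitToolkit
import HarnessLib

/-!
# Dissipation rigidity — G: the contradiction along a bad sequence

Helper for the line `empirical-h-theorem` of the crux `InformationPercolationEngine.ChaosClosesEuler`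
(stmt-AtomisticToContinuum-15141), registered stub `stub_dissipationRigidity`.

`false_of_bad_sequence`: there is no sequence of finite measures `mₖ` on `ℝ³` in the class {mass `∈ [ρ₁, ρ₂]`,
`|v|²` integrable with the tail schedule `Lt` up to level `k`, own temperature `≥ θ₁ > 0`} with floors
`Kₖ → ∞` (`Kₖ ≥ 0`), cuts `Lₖ → ∞`, smoothed-law dissipations `D_{Kₖ,Lₖ}(mₖ) ≤ ηₖ → 0` and `ψ`-moment
defects `> ε` for all `k`.  Proof (compactness + Boltzmann + Gauss, files A–F and the lead's landed
quantitative-rigidity toolkit): extract `m_{φ(k)} ⇀ μ` with uniformly integrable second moments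
(`exists_subseq_tendsto_of_mass_le_of_tail`), pass masses and first/second moments to the limit
(`stub_weakLimitToolkit`), so the own parameters converge and `θ(μ) ≥ θ₁`; the coarse-grained laws `g_k → g_μ`
and smoothed exponents `Λ_k → Λ_μ` converge pointwise with uniform quadratic domination (file F), all
continuous (file A); Fatou and detailed balance make `Λ_μ` quadratic (file C); heat deconvolution makes
`log g_μ` quadratic (files D, F); so `μ` is a Maxwellian measure or a point mass (file E); the point mass is
excluded by `θ(μ) ≥ θ₁ > 0`, and in the Maxwellian case the defects tend to `0` by weak convergence and the
continuity of the Maxwellian pairing in its parameters — contradiction.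

References: C. Cercignani, R. Illner, M. Pulvirenti, *The Mathematical Theory of Dilute Gases* (1994),
§3.1–3.2; P. Billingsley, *Convergence of Probability Measures* (1999), §5.
-/

noncomputable section

namespace Summit.AtomisticToContinuum.HydrodynamicLimit.Theorems.ChaosClosesEulerDissipationRigidity

open scoped BigOperators Topology Classical MeasureTheory ENNReal InnerProductSpace
open Filter Set MeasureTheory
open Literature.MathematicalPhysics.KineticTheory
open Literature.Analysis.FluidPDE
open Summit.AtomisticToContinuum.HydrodynamicLimit.Theorems
open Summit.AtomisticToContinuum.HydrodynamicLimit.Theorems.ChaosClosesEulerQuantitativeRigidity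

/-- A function of the form `|log g| ≤ A + |u|²/θ` minus a quadratic polynomial has quadratic growth. [folklore] -/
theorem abs_sub_quadratic_le {θ A : ℝ} (hθ : 0 < θ) (hA : 0 ≤ A) {f : V3 → ℝ} (hf : ∀ u, |f u| ≤ A + ‖u‖ ^ 2 / θ)
    (a c : ℝ) (b : V3) (u : V3) :
    |f u - (a + ⟪b, u⟫_ℝ + c * ‖u‖ ^ 2)| ≤ (A + |a| + ‖b‖ + |c| + θ⁻¹) * (1 + ‖u‖ ^ 2) := by
  have h1 : |⟪b, u⟫_ℝ| ≤ ‖b‖ * (1 + ‖u‖ ^ 2) := by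
    refine (abs_real_inner_le_norm b u).trans (mul_le_mul_of_nonneg_left ?_ (norm_nonneg b))
    nlinarith [norm_nonneg u, sq_nonneg (‖u‖ - 1)]
  have h2 : |f u - (a + ⟪b, u⟫_ℝ + c * ‖u‖ ^ 2)| ≤ |f u| + |a| + |⟪b, u⟫_ℝ| + |c| * ‖u‖ ^ 2 := by
    have e1 := abs_sub (f u) (a + ⟪b, u⟫_ℝ + c * ‖u‖ ^ 2)
    have e2 := abs_add_le (a + ⟪b, u⟫_ℝ) (c * ‖u‖ ^ 2)
    have e3 := abs_add_le a ⟪b, u⟫_ℝ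
    rw [abs_mul, abs_of_nonneg (sq_nonneg ‖u‖)] at e2
    linarith
  have h3 : ‖u‖ ^ 2 / θ = θ⁻¹ * ‖u‖ ^ 2 := by rw [div_eq_inv_mul]
  have hu : 0 ≤ ‖u‖ ^ 2 := sq_nonneg _
  have hfu := hf u
  rw [h3] at hfu
  nlinarith [hfu, abs_nonneg a, abs_nonneg c, norm_nonneg b, inv_nonneg.2 hθ.le,
    mul_nonneg (abs_nonneg c) hu, mul_nonneg (inv_nonneg.2 hθ.le) hu, mul_nonneg hA hu,
    mul_nonneg (abs_nonneg a) hu]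

/-- **No bad sequence.** See the file header. [folklore] -/
theorem false_of_bad_sequence (Lt : ℕ → ℝ) {ρ₁ ρ₂ θ₁ : ℝ} (hρ₁ : 0 < ρ₁) (hθ₁ : 0 < θ₁)
    {ψ : V3 → ℝ} (hψ : Continuous ψ) (hC : ∃ C : ℝ, ∀ v, |ψ v| ≤ C) {δ : ℝ} (hδ : 0 < δ) {ε : ℝ} (hε : 0 < ε)
    {K L η : ℕ → ℝ} (hK0 : ∀ k, 0 ≤ K k) (hK : Tendsto K atTop atTop) (hL : Tendsto L atTop atTop)
    (hη : Tendsto η atTop (𝓝 0))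
    (m : ℕ → Measure V3) (hfin : ∀ k, IsFiniteMeasure (m k))
    (hint : ∀ k, Integrable (fun v : V3 => ‖v‖ ^ 2) (m k))
    (hlo : ∀ k, ρ₁ ≤ ((m k) Set.univ).toReal) (hhi : ∀ k, ((m k) Set.univ).toReal ≤ ρ₂)
    (htail : ∀ k j : ℕ, j ≤ k → ∫ v in {v : V3 | Lt j < ‖v‖}, ‖v‖ ^ 2 ∂(m k) ≤ 1 / ((j : ℝ) + 1))
    (hθ : ∀ k, θ₁ ≤ 2 / 3 * ((∫ v, ‖v‖ ^ 2 / 2 ∂(m k)) / ((m k) Set.univ).toReal -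
      ‖∫ v, v ∂(m k)‖ ^ 2 / (2 * ((m k) Set.univ).toReal ^ 2)))
    {g Λ : ℕ → V3 → ℝ} (hg : ∀ k v, g k v = ∫ w, localMaxwellian 1 (δ ^ 2) 0 (v - w) ∂(m k))
    (hΛ : ∀ k v, Λ k v = ∫ u, localMaxwellian 1 (δ ^ 2) 0 (v - u) *
      (if Real.exp (-K k) * ((1 + ‖u‖ ^ 2) ^ 2)⁻¹ ≤ g k u then Real.log (g k u)
        else Real.log (Real.exp (-K k) * ((1 + ‖u‖ ^ 2) ^ 2)⁻¹) +
          (g k u - Real.exp (-K k) * ((1 + ‖u‖ ^ 2) ^ 2)⁻¹) / (Real.exp (-K k) * ((1 + ‖u‖ ^ 2) ^ 2)⁻¹)))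
    (hD : ∀ k, ∫ v, ∫ u, (if ‖v‖ ^ 2 + ‖u‖ ^ 2 ≤ L k then (1 : ℝ) else 0) *
      (∫ ω : Metric.sphere (0 : V3) 1, (Λ k v + Λ k u - Λ k (collide ω (v, u)).1 -
        Λ k (collide ω (v, u)).2) * hardSphereKernel (u, v) ω ∂sphereMeasure) *
          (Real.exp (Λ k v) * Real.exp (Λ k u)) ≤ η k)
    (hbad : ∀ k, ε < |(∫ v, ψ v ∂(m k)) - ((m k) Set.univ).toReal * ∫ v, ψ v *
      localMaxwellian 1 (2 / 3 * ((∫ v, ‖v‖ ^ 2 / 2 ∂(m k)) / ((m k) Set.univ).toReal -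
        ‖∫ v, v ∂(m k)‖ ^ 2 / (2 * ((m k) Set.univ).toReal ^ 2))) ((((m k) Set.univ).toReal)⁻¹ • ∫ v, v ∂(m k)) v|) :
    False := by
  have hδ2 : 0 < δ ^ 2 := by positivity
  -- Step 1: compactness — a weakly convergent subsequence with uniformly integrable second moments
  obtain ⟨φ, hφ, μ, hconv, hUI⟩ := exists_subseq_tendsto_of_mass_le_of_tail m hfin hint hρ₁ hlo hhi Lt htail
  -- Step 2: the weak-limit toolkit along the subsequence
  obtain ⟨h2μ, hmass, hP, -, hE, -⟩ := ChaosClosesEulerWeakLimitToolkit.stub_weakLimitToolkit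
    (fun n => (⟨m (φ n), hfin (φ n)⟩ : FiniteMeasure V3)) μ hconv (fun n => hint (φ n)) hUI
  simp only [FiniteMeasure.toMeasure_mk] at hmass hP hE
  -- Step 3: limits of the own parameters
  have hρ₁le : ρ₁ ≤ ((μ : Measure V3) Set.univ).toReal := ge_of_tendsto' hmass fun n => hlo (φ n)
  have hρpos : 0 < ((μ : Measure V3) Set.univ).toReal := hρ₁.trans_le hρ₁le
  have hμhi : ((μ : Measure V3) Set.univ).toReal ≤ ρ₂ := le_of_tendsto' hmass fun n => hhi (φ n)
  have hPlim : Tendsto (fun n => ∫ v, v ∂(m (φ n))) atTop (𝓝 (∫ v, v ∂(μ : Measure V3))) :=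
    tendsto_integral_id (fun n => integrable_id_of_sq (hint (φ n))) (integrable_id_of_sq h2μ) hP
  have hElim : Tendsto (fun n => ∫ v, ‖v‖ ^ 2 / 2 ∂(m (φ n))) atTop
      (𝓝 (∫ v, ‖v‖ ^ 2 / 2 ∂(μ : Measure V3))) := by
    simp only [integral_div]
    exact hE.div_const 2
  have hθlim : Tendsto (fun n => 2 / 3 * ((∫ v, ‖v‖ ^ 2 / 2 ∂(m (φ n))) / ((m (φ n)) Set.univ).toReal -
      ‖∫ v, v ∂(m (φ n))‖ ^ 2 / (2 * ((m (φ n)) Set.univ).toReal ^ 2))) atTop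
      (𝓝 (2 / 3 * ((∫ v, ‖v‖ ^ 2 / 2 ∂(μ : Measure V3)) / ((μ : Measure V3) Set.univ).toReal -
        ‖∫ v, v ∂(μ : Measure V3)‖ ^ 2 / (2 * ((μ : Measure V3) Set.univ).toReal ^ 2)))) :=
    ((hElim.div hmass hρpos.ne').sub ((hPlim.norm.pow 2).div ((hmass.pow 2).const_mul 2)
      (by positivity))).const_mul (2 / 3)
  have hθ₁le : θ₁ ≤ 2 / 3 * ((∫ v, ‖v‖ ^ 2 / 2 ∂(μ : Measure V3)) / ((μ : Measure V3) Set.univ).toReal -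
      ‖∫ v, v ∂(μ : Measure V3)‖ ^ 2 / (2 * ((μ : Measure V3) Set.univ).toReal ^ 2)) :=
    ge_of_tendsto' hθlim fun n => hθ (φ n)
  have hulim : Tendsto (fun n => (((m (φ n)) Set.univ).toReal)⁻¹ • ∫ v, v ∂(m (φ n))) atTop
      (𝓝 ((((μ : Measure V3) Set.univ).toReal)⁻¹ • ∫ v, v ∂(μ : Measure V3))) :=
    (hmass.inv₀ hρpos.ne').smul hPlim
  -- Step 4: the coarse-grained laws: positivity and uniform logarithmic bounds
  set cδ : ℝ := (2 * Real.pi * δ ^ 2) ^ (-(Module.finrank ℝ V3 : ℝ) / 2) with hcδ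
  set R₀ : ℝ := max (Lt 0) (max 1 (Real.sqrt (2 / ρ₁))) with hR₀
  have hball : ∀ k, ρ₁ / 2 ≤ ((m k) (Metric.closedBall (0 : V3) R₀)).toReal := fun k => by
    haveI := hfin k
    refine half_mass_le_closedBall (hint k) hρ₁ (hlo k) ?_
    have h := htail k 0 (Nat.zero_le k)
    rwa [Nat.cast_zero, zero_add, div_one] at h
  obtain ⟨R₁, hR₁⟩ := exists_closedBall_measure_ge (μ : Measure V3) (μ₀ := ρ₁ / 2) (by linarith)
  set A : ℝ := max (|Real.log (ρ₁ / 2 * (cδ * Real.exp (-(2 * R₀ ^ 2) / (2 * δ ^ 2))))| +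
      |Real.log (ρ₂ * cδ)|) (|Real.log (ρ₁ / 2 * (cδ * Real.exp (-(2 * R₁ ^ 2) / (2 * δ ^ 2))))| +
      |Real.log (ρ₂ * cδ)|) with hA
  have hA0 : 0 ≤ A := by rw [hA]; positivity
  have hgpos : ∀ k u, 0 < g k u := fun k u => by
    haveI := hfin k
    rw [hg k u]
    exact lt_of_lt_of_le (by positivity) (smoothedLaw_ge hδ2 (m k) (hball k) u)
  have hgbd : ∀ k u, |Real.log (g k u)| ≤ A + ‖u‖ ^ 2 / δ ^ 2 := fun k u => by
    haveI := hfin k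
    rw [hg k u]
    refine (abs_log_smoothedLaw_le hδ2 (m k) (by positivity) (hball k) (hhi k) u).trans ?_
    exact add_le_add (le_max_left _ _) le_rfl
  set gμ : V3 → ℝ := fun v => ∫ w, localMaxwellian 1 (δ ^ 2) 0 (v - w) ∂(μ : Measure V3) with hgμ
  have hμpos : ∀ u, 0 < gμ u := fun u =>
    lt_of_lt_of_le (by positivity) (smoothedLaw_ge hδ2 (μ : Measure V3) hR₁ u)
  have hμbd : ∀ u, |Real.log (gμ u)| ≤ A + ‖u‖ ^ 2 / δ ^ 2 := fun u => by
    refine (abs_log_smoothedLaw_le hδ2 (μ : Measure V3) (by positivity) hR₁ hμhi u).trans ?_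
    exact add_le_add (le_max_right _ _) le_rfl
  -- continuity
  have hgc : ∀ k, Continuous (g k) := fun k => by
    haveI := hfin k
    rw [show g k = fun v => ∫ w, localMaxwellian 1 (δ ^ 2) 0 (v - w) ∂(m k) from funext (hg k)]
    exact continuous_smoothedLaw hδ2 (m k)
  have hgμc : Continuous gμ := continuous_smoothedLaw hδ2 (μ : Measure V3)
  have hquadbd : ∀ {f : V3 → ℝ}, (∀ u, |f u| ≤ A + ‖u‖ ^ 2 / δ ^ 2) → ∀ u, |f u| ≤ A + (δ ^ 2)⁻¹ * ‖u‖ ^ 2 :=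
    fun hf u => by rw [← div_eq_inv_mul]; exact hf u
  have hΛc : ∀ k, Continuous (Λ k) := fun k => by
    rw [show Λ k = _ from funext (hΛ k)]
    refine continuous_conv_phi hδ2 (continuous_flooredLog_comp (K k) (hgc k) (hgpos k)) (a := A)
      (b := (δ ^ 2)⁻¹) fun u => ?_
    refine (abs_flooredLog_le (floor_pos (K k) u) (floor_le_one (hK0 k) u) (hgpos k u)).trans ?_
    exact hquadbd (hgbd k) u
  set Λμ : V3 → ℝ := fun v => ∫ u, localMaxwellian 1 (δ ^ 2) 0 (v - u) * Real.log (gμ u) with hΛμ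
  have hΛμc : Continuous Λμ :=
    continuous_conv_phi hδ2 (hgμc.log fun u => (hμpos u).ne') (a := A) (b := (δ ^ 2)⁻¹) (hquadbd hμbd)
  -- pointwise convergence along the subsequence
  have hgt : ∀ u, Tendsto (fun n => g (φ n) u) atTop (𝓝 (gμ u)) := fun u => by
    have h := tendsto_smoothedLaw hδ2 hconv u
    simp only [FiniteMeasure.toMeasure_mk] at h
    simpa only [hg] using h
  have hΛt : ∀ v, Tendsto (fun n => Λ (φ n) v) atTop (𝓝 (Λμ v)) := fun v =>
    (tendsto_smoothedExponent hδ2 (gs := fun n => g (φ n)) (fun n => hgc (φ n))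
      (fun n => hgpos (φ n)) hμpos hgt (fun n => hgbd (φ n)) (K := fun n => K (φ n))
      (hK.comp hφ.tendsto_atTop) (fun n => hK0 (φ n)) v).congr fun n => (hΛ (φ n) v).symm
  -- Step 5: zero dissipation in the limit ⇒ `Λμ` quadratic
  obtain ⟨a, c, b, hquad⟩ := exists_eq_quadratic_of_dissipation_le (Λs := fun n => Λ (φ n))
    (fun n => hΛc (φ n)) hΛμc hΛt (hL.comp hφ.tendsto_atTop) (hη.comp hφ.tendsto_atTop) (fun n => hD (φ n))
  -- Step 6: heat deconvolution ⇒ `log gμ` quadratic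
  have hlogq : ∀ u, Real.log (gμ u) = (a - 3 * c * δ ^ 2) + ⟪b, u⟫_ℝ + c * ‖u‖ ^ 2 := by
    set F : V3 → ℝ := fun u => Real.log (gμ u) - ((a - 3 * c * δ ^ 2) + ⟪b, u⟫_ℝ + c * ‖u‖ ^ 2) with hF
    have hFc : Continuous F := (hgμc.log fun u => (hμpos u).ne').sub (by fun_prop)
    have hFb := abs_sub_quadratic_le hδ2 hA0 hμbd (a - 3 * c * δ ^ 2) c b
    have hlogi : ∀ v, Integrable (fun u => localMaxwellian 1 (δ ^ 2) 0 (v - u) * Real.log (gμ u)) :=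
      fun v => integrable_phi_mul hδ2 (hgμc.log fun u => (hμpos u).ne').aestronglyMeasurable (hquadbd hμbd) v
    have hF0 : ∀ v, ∫ u, localMaxwellian 1 (δ ^ 2) 0 (v - u) * F u = 0 := by
      intro v
      have hqi : Integrable (fun u => localMaxwellian 1 (δ ^ 2) 0 (v - u) *
          ((a - 3 * c * δ ^ 2) + ⟪b, u⟫_ℝ + c * ‖u‖ ^ 2)) :=
        integrable_phi_mul hδ2 (by fun_prop) (a := |a - 3 * c * δ ^ 2| + ‖b‖ + |c|) (b := ‖b‖ + |c|)
          (fun u => by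
            have h1 : |⟪b, u⟫_ℝ| ≤ ‖b‖ * (1 + ‖u‖ ^ 2) := by
              refine (abs_real_inner_le_norm b u).trans (mul_le_mul_of_nonneg_left ?_ (norm_nonneg b))
              nlinarith [norm_nonneg u, sq_nonneg (‖u‖ - 1)]
            have e2 := abs_add_le ((a - 3 * c * δ ^ 2) + ⟪b, u⟫_ℝ) (c * ‖u‖ ^ 2)
            have e3 := abs_add_le (a - 3 * c * δ ^ 2) ⟪b, u⟫_ℝ
            rw [abs_mul, abs_of_nonneg (sq_nonneg ‖u‖)] at e2
            nlinarith [abs_nonneg c, sq_nonneg ‖u‖, norm_nonneg b]) v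
      simp only [hF, mul_sub]
      rw [integral_sub (hlogi v) hqi, conv_phi_quadratic hδ2]
      have := hquad v
      simp only [hΛμ] at this
      rw [this]
      ring
    intro u
    have h := eq_zero_of_gaussian_conv_eq_zero hδ hFc hFb hF0 u
    simp only [hF] at h
    linarith
  -- Step 7: identification of the limit
  rcases exists_maxwellian_or_dirac_of_log_smoothedLaw_quadratic hδ (μ : Measure V3) hμpos hlogq with
    ⟨ρ, θ, u, hρ, hθg, hμeq⟩ | ⟨cm, u, hμeq⟩
  · -- the Maxwellian case: parameters are the limits of the own parameters
    obtain ⟨hfinM, hintM, hmassM, hPM, -, hEM, hψM⟩ :=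
      ChaosClosesEulerMaxwellianMoments.stub_maxwellianMoments ρ θ u hρ hθg
    haveI := hfinM
    have hPvec : ∫ v, v ∂(volume.withDensity fun v => ENNReal.ofReal (localMaxwellian ρ θ u v)) = ρ • u :=
      integral_id_eq_smul (integrable_id_of_sq hintM) hPM
    obtain ⟨hθM, huM⟩ := ownParams_of_moments hρ hmassM hPvec hEM
    rw [hμeq] at hθlim hulim hmass
    rw [hθM] at hθlim
    rw [huM] at hulim
    rw [hmassM] at hmass
    obtain ⟨C, hC'⟩ := hC
    have hψlim : Tendsto (fun n => ∫ v, ψ v ∂(m (φ n))) atTop (𝓝 (∫ v, ψ v ∂(μ : Measure V3))) := by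
      have h := EvenStressEnskog.QuadraticTest.tendsto_integral_of_abs_le hconv hψ hC'
      simpa only [FiniteMeasure.toMeasure_mk] using h
    rw [hμeq, (hψM ψ hψ ⟨C, hC'⟩).2] at hψlim
    have hI := tendsto_integral_mul_localMaxwellian hψ ⟨C, hC'⟩ hθg hulim hθlim
    have hfinal := (hψlim.sub (hmass.mul hI)).abs
    have hle : ε ≤ |(ρ * ∫ v, ψ v * localMaxwellian 1 θ u v) - ρ * ∫ v, ψ v * localMaxwellian 1 θ u v| :=
      ge_of_tendsto' hfinal fun n => (hbad (φ n)).le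
    rw [sub_self, abs_zero] at hle
    exact lt_irrefl _ (hε.trans_le hle)
  · -- a point mass has own temperature `0 < θ₁`: excluded
    rw [hμeq] at hθ₁le
    exact lt_irrefl _ (hθ₁.trans_le (hθ₁le.trans_eq (ownTemperature_dirac cm u)))

/-! ## Registered sub-goal -/

/-- **Registered sub-goal `stub_dissipationRigidityG` (helper G of `stub_dissipationRigidity`): the heat
deconvolution input has quadratic growth — `|f − (a + ⟪b,·⟫ + c|·|²)| ≤ C(1 + |u|²)` when
`|f| ≤ A + |u|²/θ`.** [folklore] -/
theorem stub_dissipationRigidityG : ∀ {θ A : ℝ}, 0 < θ → 0 ≤ A → ∀ {f : V3 → ℝ}, (∀ u, |f u| ≤ A + ‖u‖ ^ 2 / θ) → ∀ (a c : ℝ) (b : V3) (u : V3), |f u - (a + ⟪b, u⟫_ℝ + c * ‖u‖ ^ 2)| ≤ (A + |a| + ‖b‖ + |c| + θ⁻¹) * (1 + ‖u‖ ^ 2) :=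
  fun hθ hA _ hf a c b u => abs_sub_quadratic_le hθ hA hf a c b u

end Summit.AtomisticToContinuum.HydrodynamicLimit.Theorems.ChaosClosesEulerDissipationRigidity

end
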